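import Literature.NumberTheory.GaloisCohomology.Howard2004.DVRSettingEngineChebProofs
import HarnessLib

/-!
# Howard 2004, Lemma 1.6.4 on a `DVRSetting`: the ENGINE's Čebotarev binder `hchebII` (Case ii) (proofs file)

Topic `NumberTheory/GaloisCohomology/Howard2004` (sequel to `DVRSettingEngineChebProofs` (`hchebI`, Case i) and
`ResidualSelmerEigenParityProofs` (Lemma 1.5.3 (a)/(b) between the eigenparts of `Sel_{F̄(nℓ)}` and `Sel_{F̄(n)}`)).
THEOREMS ONLY: no definition, no named fact, no instance, no notation, no `sorry`.

B. Howard, *The Heegner point Kolyvagin system*, Compositio Math. 140 (2004) = arXiv:1202.6340, Lemma 1.6.4, proof,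
Case ii (p. 12 L15–27): «either `ρ(n)⁺` or `ρ(n)⁻` is zero. Assume `ρ(n)⁻ = 0`, so that `ρ(n)⁺ ≥ 2` … it has some
nonzero multiple `d ∈ Stub^{(k)}(n)[𝔪] ⊂ H¹_{F(n)}(K,T̄)⁺` … Lemma 1.6.2 … `ℓ ∈ 𝓛^{(2k-1)}` such that `loc_ℓ(d) ≠ 0`.  By
Lemma 1.5.3 `ρ(nℓ)⁺ = ρ(n)⁺ − 1`, `ρ(nℓ)⁻ = ρ(n)⁻ + 1`.  We may therefore assume that `ρ(nℓ) = ρ(n)` and `ρ(nℓ)^± > 0`».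
This is the binder `hchebII` of `DVRSettingEngineRedProofs.mem_stub_of_stubLemmaInduction_levels_guarded` /
`DVRSettingEngineData.mem_stub_of_stubLemmaInduction_levels'`, in the binder currency of `exists_enginePrime_caseI`
(same `ρp ρm hρp hρm hdis hGD^± hor^±`; `H k n`, `loc` read on the underlying classes).

* `exists_enginePrime_caseII_of_minus_eq_zero` (`ρ(n)⁻ = 0`, `ρ(n)⁺ ≥ 2`), `exists_enginePrime_caseII_of_plus_eq_zero`
  (`ρ(n)⁺ = 0`, `ρ(n)⁻ ≥ 2`), **`exists_enginePrime_caseII`** — the binder `hchebII` (class currency).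
(The same two binders in the ENGINE's own currency — `↥(S.selmerModuleAt hy k n)`, `locR.domRestrict`, the `ρ±` letters of
`DVRSettingEngineRhoProofs.exists_eigenLengths` — follow in `DVRSettingEngineChebBindersProofs`.)

Cell `pub/bsd-print-x9`, G87 = Howard Thm. 1.6.1 (print leaf `stub_h161` of stmt-BirchSwinnertonDyer-22642); seat
`bsd-line-x10b-p1-w6` g9, brick (ENGINE-hcheb) part 2d.  `thm161_dvrKolyvaginBound` is NOT proved; BSD is not proved by
any of this.

References: [Howard2004HeegnerKolyvagin] Lemma 1.5.3, Lemma 1.6.2, Lemma 1.6.4.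
-/

set_option autoImplicit false

noncomputable section

open Function NumberField IsDedekindDomain Field
open scoped NumberField ContRepresentation Classical

namespace Literature.NumberTheory.GaloisCohomology.Howard2004

open Literature.NumberTheory.GaloisRepresentations
open Literature.NumberTheory.GaloisRepresentations.DiscreteGaloisModule
open Literature.NumberTheory.EllipticCurves

namespace DVRSetting

variable {p : ℕ} [Fact p.Prime] {K : Type} [Field K] [NumberField K]
  {R : Type} [CommRing R] [IsDomain R] [IsDiscreteValuationRing R] [Algebra ℤ_[p] R]
  {N : ℕ → Type} [∀ k, AddCommGroup (N k)] [∀ k, TopologicalSpace (N k)]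
  [∀ k, DiscreteTopology (N k)] [∀ k, Module R (N k)]
  {Rk : ℕ → Type} [∀ k, CommRing (Rk k)] [∀ k, IsLocalRing (Rk k)] [∀ k, TopologicalSpace (Rk k)]
  [∀ k, DiscreteTopology (Rk k)] [∀ k, Algebra ℤ_[p] (Rk k)] [∀ k, Algebra R (Rk k)]
  [∀ k, Module (Rk k) (N k)] [∀ k, IsScalarTower R (Rk k) (N k)]
  {Nbar : Type} [AddCommGroup Nbar] [TopologicalSpace Nbar] [DiscreteTopology Nbar]
  [∀ k, Module (Rk k) Nbar]
  {Nq : ℕ → Finset (HeightOneSpectrum (𝓞 K)) → Type} [∀ k n, AddCommGroup (Nq k n)]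
  [∀ k n, TopologicalSpace (Nq k n)] [∀ k n, DiscreteTopology (Nq k n)]
  [∀ k n, Module (Rk k) (Nq k n)] [∀ k n, Module R (Nq k n)]
  [∀ k n, IsScalarTower R (Rk k) (Nq k n)]

/-! ## The binder `hchebII` (Case ii of Lemma 1.6.4) -/

/-- **Lemma 1.6.4, Case ii with `ρ(n)⁻ = 0`, `ρ(n)⁺ ≥ 2`** (the engine binder `hchebII`, first alternative): for
`d ∈ H¹_{F(n)}(K,T^{(k)})`, `d ≠ 0`, `π d = 0`, there is `ℓ ∈ 𝓛^{(2k-1)} ∖ n` with `loc_ℓ d ≠ 0`, `ρ(nℓ)^± > 0` and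
`ρ(nℓ)⁺ + ρ(nℓ)⁻ = ρ(n)⁺ + ρ(n)⁻` (`d̄ = d̄⁺`; Lemma 1.5.3 (a) for `+`, (b) for `−`). [cite: Howard2004HeegnerKolyvagin, Lemma 1.6.4, Case ii (arXiv:1202.6340 p. 12 L15–27), with Lemma 1.6.2 and Lemma 1.5.3] -/
theorem exists_enginePrime_caseII_of_minus_eq_zero [Finite Nbar] [∀ k, Finite (N k)]
    (S : DVRSetting p K R N Rk Nbar Nq) (hy : S.SatisfiesH) (hC : Automorphic.chebotarev_artinRep)
    (hp0 : ((p : ℕ) : R) ≠ 0) (hL : S.LargePrimes) (k : ℕ)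
    (ρp ρm : ℕ → Finset (HeightOneSpectrum (𝓞 K)) → ℕ)
    (hρp : ∀ m : Finset (HeightOneSpectrum (𝓞 K)), ↑m ⊆ S.enginePrimes k →
      letI := galoisCohomology.moduleH1 S.ρbar (S.isScalarLinear_rhobar hy k);
      ((ρp k m : ℕ) : ℕ∞) = Module.length (Rk k) ↥(galoisCohomology.submoduleOfStable (S.isScalarLinear_rhobar hy k)
        ((((hy.h1 k).1.propagateStructure (S.t k).cond).modify (transverseStructure p S.ρbar S.jbar) ∅ ∅ m).selmerGroup ⊓
          ((semilinearH S.cd.isLift (S.A k).θ.toAddMonoidHom (S.A k).isSemilinear 1) - AddMonoidHom.id _).ker)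
        (scalarMapH1_mem_inf S.ρbar (S.isScalarLinear_rhobar hy k) (S.scalarMapH1_mem_residualSelmer_modify hy k ∅ ∅ m)
          (S.scalarMapH1_mem_kerSub hy k))))
    (hρm : ∀ m : Finset (HeightOneSpectrum (𝓞 K)), ↑m ⊆ S.enginePrimes k →
      letI := galoisCohomology.moduleH1 S.ρbar (S.isScalarLinear_rhobar hy k);
      ((ρm k m : ℕ) : ℕ∞) = Module.length (Rk k) ↥(galoisCohomology.submoduleOfStable (S.isScalarLinear_rhobar hy k)
        ((((hy.h1 k).1.propagateStructure (S.t k).cond).modify (transverseStructure p S.ρbar S.jbar) ∅ ∅ m).selmerGroup ⊓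
          ((semilinearH S.cd.isLift (S.A k).θ.toAddMonoidHom (S.A k).isSemilinear 1) + AddMonoidHom.id _).ker)
        (scalarMapH1_mem_inf S.ρbar (S.isScalarLinear_rhobar hy k) (S.scalarMapH1_mem_residualSelmer_modify hy k ∅ ∅ m)
          (S.scalarMapH1_mem_kerAdd hy k))))
    {n : Finset (HeightOneSpectrum (𝓞 K))} (hn : ↑n ⊆ S.enginePrimes k)
    (hdis : ∀ v ∈ S.enginePrimes k, v ∉ n →
      Disjoint (((hy.h1 k).1.propagateStructure (S.t k).cond) (Sum.inr v))
        ((transverseStructure p S.ρbar S.jbar) (Sum.inr v)))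
    (hGDp : ∀ v ∈ S.enginePrimes k, v ∉ n →
      letI := (galoisCohomology.moduleH1 (S.ρbar.toLocal (Sum.inr v))
        ((S.isScalarLinear_rhobar hy k).restrictField (Place.Completion (Sum.inr v))));
      Module.length (Rk k) ↥(galoisCohomology.submoduleOfStable
        ((S.isScalarLinear_rhobar hy k).restrictField (Place.Completion (Sum.inr v)))
        (((((hy.h1 k).1.propagateStructure (S.t k).cond).modify (transverseStructure p S.ρbar S.jbar) {v} ∅ n).selmerGroup ⊓
          ((semilinearH S.cd.isLift (S.A k).θ.toAddMonoidHom (S.A k).isSemilinear 1) - AddMonoidHom.id _).ker).map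
          (galoisCohomology.localization S.ρbar (Sum.inr v) 1))
        (scalarMapH1_mem_map_localization S.ρbar (S.isScalarLinear_rhobar hy k) (Sum.inr v)
          (scalarMapH1_mem_inf S.ρbar (S.isScalarLinear_rhobar hy k) (S.scalarMapH1_mem_residualSelmer_modify hy k {v} ∅ n)
          (S.scalarMapH1_mem_kerSub hy k)))) = 1)
    (horp : ∀ v ∈ S.enginePrimes k, v ∉ n →
      ((((hy.h1 k).1.propagateStructure (S.t k).cond).modify (transverseStructure p S.ρbar S.jbar) {v} ∅ n).selmerGroup ⊓
          ((semilinearH S.cd.isLift (S.A k).θ.toAddMonoidHom (S.A k).isSemilinear 1) - AddMonoidHom.id _).ker).map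
          (galoisCohomology.localization S.ρbar (Sum.inr v) 1) ≤
          ((hy.h1 k).1.propagateStructure (S.t k).cond) (Sum.inr v) ∨
      ((((hy.h1 k).1.propagateStructure (S.t k).cond).modify (transverseStructure p S.ρbar S.jbar) {v} ∅ n).selmerGroup ⊓
          ((semilinearH S.cd.isLift (S.A k).θ.toAddMonoidHom (S.A k).isSemilinear 1) - AddMonoidHom.id _).ker).map
          (galoisCohomology.localization S.ρbar (Sum.inr v) 1) ≤
          (transverseStructure p S.ρbar S.jbar) (Sum.inr v))
    (hGDm : ∀ v ∈ S.enginePrimes k, v ∉ n →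
      letI := (galoisCohomology.moduleH1 (S.ρbar.toLocal (Sum.inr v))
        ((S.isScalarLinear_rhobar hy k).restrictField (Place.Completion (Sum.inr v))));
      Module.length (Rk k) ↥(galoisCohomology.submoduleOfStable
        ((S.isScalarLinear_rhobar hy k).restrictField (Place.Completion (Sum.inr v)))
        (((((hy.h1 k).1.propagateStructure (S.t k).cond).modify (transverseStructure p S.ρbar S.jbar) {v} ∅ n).selmerGroup ⊓
          ((semilinearH S.cd.isLift (S.A k).θ.toAddMonoidHom (S.A k).isSemilinear 1) + AddMonoidHom.id _).ker).map
          (galoisCohomology.localization S.ρbar (Sum.inr v) 1))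
        (scalarMapH1_mem_map_localization S.ρbar (S.isScalarLinear_rhobar hy k) (Sum.inr v)
          (scalarMapH1_mem_inf S.ρbar (S.isScalarLinear_rhobar hy k) (S.scalarMapH1_mem_residualSelmer_modify hy k {v} ∅ n)
          (S.scalarMapH1_mem_kerAdd hy k)))) = 1)
    (horm : ∀ v ∈ S.enginePrimes k, v ∉ n →
      ((((hy.h1 k).1.propagateStructure (S.t k).cond).modify (transverseStructure p S.ρbar S.jbar) {v} ∅ n).selmerGroup ⊓
          ((semilinearH S.cd.isLift (S.A k).θ.toAddMonoidHom (S.A k).isSemilinear 1) + AddMonoidHom.id _).ker).map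
          (galoisCohomology.localization S.ρbar (Sum.inr v) 1) ≤
          ((hy.h1 k).1.propagateStructure (S.t k).cond) (Sum.inr v) ∨
      ((((hy.h1 k).1.propagateStructure (S.t k).cond).modify (transverseStructure p S.ρbar S.jbar) {v} ∅ n).selmerGroup ⊓
          ((semilinearH S.cd.isLift (S.A k).θ.toAddMonoidHom (S.A k).isSemilinear 1) + AddMonoidHom.id _).ker).map
          (galoisCohomology.localization S.ρbar (Sum.inr v) 1) ≤
          (transverseStructure p S.ρbar S.jbar) (Sum.inr v))
    (hzero : ρm k n = 0) (htwo : 2 ≤ ρp k n)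
    {d : galoisCohomology (S.T.ρ k) 1} (hd : d ∈ (((S.t k).atLevel S.jbar n).cond).selmerGroup) (hd0 : d ≠ 0)
    (hπ : galoisCohomology.scalarMapH1 (S.T.ρ k) (S.T.hlin k) S.π d = 0) :
    ∃ ℓ ∈ S.enginePrimes k, ℓ ∉ n ∧ galoisCohomology.localization (S.T.ρ k) (Sum.inr ℓ) 1 d ≠ 0 ∧
      0 < ρp k (insert ℓ n) ∧ 0 < ρm k (insert ℓ n) ∧
      ρp k (insert ℓ n) + ρm k (insert ℓ n) = ρp k n + ρm k n := by
  have hnσ : ∀ w ∈ n, S.cd.σ • w = w := fun w hw => S.sigma_smul_eq_self_of_mem_L hy (hn hw).1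
  have h0σ : ∀ w ∈ (∅ : Finset (HeightOneSpectrum (𝓞 K))), S.cd.σ • w = w :=
    fun w hw => absurd hw (Finset.notMem_empty w)
  -- Step 1: the residual class
  obtain ⟨ι, hι, dbar, hdbar, hdbar0, rfl⟩ := S.exists_residual_of_scalarMapH1_pi_eq_zero hy k hn hd hd0 hπ
  -- Step 2: `d̄` is an eigenclass (the other eigenpart of `Sel_{F̄(n)}` vanishes)
  obtain ⟨cp, cm, hcp, hcm, hτp, hτm, hsum, -⟩ :=
    S.exists_eigen_decomposition_mem_ne_zero hy k h0σ hnσ hdbar hdbar0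
  have hlen0 : letI := galoisCohomology.moduleH1 S.ρbar (S.isScalarLinear_rhobar hy k);
      Module.length (Rk k) ↥(galoisCohomology.submoduleOfStable (S.isScalarLinear_rhobar hy k)
        ((((hy.h1 k).1.propagateStructure (S.t k).cond).modify (transverseStructure p S.ρbar S.jbar) ∅ ∅ n).selmerGroup ⊓
          ((semilinearH S.cd.isLift (S.A k).θ.toAddMonoidHom (S.A k).isSemilinear 1) + AddMonoidHom.id _).ker)
        (scalarMapH1_mem_inf S.ρbar (S.isScalarLinear_rhobar hy k) (S.scalarMapH1_mem_residualSelmer_modify hy k ∅ ∅ n)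
          (S.scalarMapH1_mem_kerAdd hy k))) = 0 := by
    rw [← hρm n hn, hzero, Nat.cast_zero]
  have hvan : cm = 0 :=
    eq_zero_of_length_eq_zero S.ρbar (S.isScalarLinear_rhobar hy k) _ hlen0
      ⟨hcm, (ResidualTau.mem_ker_add_iff (S.A k) cm).2 hτm⟩
  have hdk : dbar = cp := by rw [hsum, hvan, add_zero]
  -- Step 3: an eigencocycle for `d̄` and the Čebotarev prime (one class)
  obtain ⟨φ, hφc, hφ⟩ := ResidualTau.exists_eigencocycle_of_semilinearH_eq (S.A k) (S.isScalarLinear_rhobar hy k) (S.isUnit_two hy k) cp hτp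
  have hseen := S.exists_mem_enginePrimes_localization_ne_zero_single hy hC hp0 hL k n φ (ε := 1) (Or.inl rfl)
    (fun g => by rw [hφ g, one_smul]) (by rw [hφc, ← hdk]; exact hdbar0)
  obtain ⟨v, hvP, hvn, _hvSig, hlφ, htriv⟩ := hseen
  have hldbar : (galoisCohomology.localization S.ρbar (Sum.inr v) 1) dbar ≠ 0 := by
    rw [hdk, ← hφc]; exact hlφ
  have hins : (↑(insert v n) : Set (HeightOneSpectrum (𝓞 K))) ⊆ S.enginePrimes k := by
    rw [Finset.coe_insert]
    exact Set.insert_subset hvP hn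
  -- Step 4: Lemma 1.5.3 (a) for the sign of `d̄`, (b) for the other sign
  have ha := S.length_eigen_insert_add_one_eq hy k hvn _ (S.scalarMapH1_mem_kerSub hy k) (hdis v hvP hvn) (hGDp v hvP hvn)
    (horp v hvP hvn) ⟨cp, ⟨by rw [← hdk]; exact hdbar, (ResidualTau.mem_ker_sub_iff (S.A k) cp).2 hτp⟩, by rw [← hdk]; exact hldbar⟩
  rw [← hρp _ hins, ← hρp n hn, ← Nat.cast_add_one, ENat.coe_inj] at ha
  have hb := S.length_eigen_insert_eq_add_one hy k hvn _ (S.scalarMapH1_mem_kerAdd hy k) (hdis v hvP hvn) (hGDm v hvP hvn)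
    (horm v hvP hvn) (fun c hc => by
      rw [eq_zero_of_length_eq_zero S.ρbar (S.isScalarLinear_rhobar hy k) _ hlen0 hc, map_zero])
  rw [← hρm _ hins, ← hρm n hn, ← Nat.cast_add_one, ENat.coe_inj] at hb
  refine ⟨v, hvP, hvn,
    S.localization_cohomologyMap_residualInclusion_ne_zero hy k ι hι (S.residualInclusion_equivariant hy k ι hι)
      v htriv hldbar, ?_, ?_, ?_⟩ <;> omega

/-- **Lemma 1.6.4, Case ii with `ρ(n)⁺ = 0`, `ρ(n)⁻ ≥ 2`** (second alternative; `d̄ = d̄⁻`).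
[cite: Howard2004HeegnerKolyvagin, Lemma 1.6.4, Case ii (arXiv:1202.6340 p. 12 L15–27), with Lemma 1.6.2 and Lemma 1.5.3] -/
theorem exists_enginePrime_caseII_of_plus_eq_zero [Finite Nbar] [∀ k, Finite (N k)]
    (S : DVRSetting p K R N Rk Nbar Nq) (hy : S.SatisfiesH) (hC : Automorphic.chebotarev_artinRep)
    (hp0 : ((p : ℕ) : R) ≠ 0) (hL : S.LargePrimes) (k : ℕ)
    (ρp ρm : ℕ → Finset (HeightOneSpectrum (𝓞 K)) → ℕ)
    (hρp : ∀ m : Finset (HeightOneSpectrum (𝓞 K)), ↑m ⊆ S.enginePrimes k →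
      letI := galoisCohomology.moduleH1 S.ρbar (S.isScalarLinear_rhobar hy k);
      ((ρp k m : ℕ) : ℕ∞) = Module.length (Rk k) ↥(galoisCohomology.submoduleOfStable (S.isScalarLinear_rhobar hy k)
        ((((hy.h1 k).1.propagateStructure (S.t k).cond).modify (transverseStructure p S.ρbar S.jbar) ∅ ∅ m).selmerGroup ⊓
          ((semilinearH S.cd.isLift (S.A k).θ.toAddMonoidHom (S.A k).isSemilinear 1) - AddMonoidHom.id _).ker)
        (scalarMapH1_mem_inf S.ρbar (S.isScalarLinear_rhobar hy k) (S.scalarMapH1_mem_residualSelmer_modify hy k ∅ ∅ m)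
          (S.scalarMapH1_mem_kerSub hy k))))
    (hρm : ∀ m : Finset (HeightOneSpectrum (𝓞 K)), ↑m ⊆ S.enginePrimes k →
      letI := galoisCohomology.moduleH1 S.ρbar (S.isScalarLinear_rhobar hy k);
      ((ρm k m : ℕ) : ℕ∞) = Module.length (Rk k) ↥(galoisCohomology.submoduleOfStable (S.isScalarLinear_rhobar hy k)
        ((((hy.h1 k).1.propagateStructure (S.t k).cond).modify (transverseStructure p S.ρbar S.jbar) ∅ ∅ m).selmerGroup ⊓
          ((semilinearH S.cd.isLift (S.A k).θ.toAddMonoidHom (S.A k).isSemilinear 1) + AddMonoidHom.id _).ker)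
        (scalarMapH1_mem_inf S.ρbar (S.isScalarLinear_rhobar hy k) (S.scalarMapH1_mem_residualSelmer_modify hy k ∅ ∅ m)
          (S.scalarMapH1_mem_kerAdd hy k))))
    {n : Finset (HeightOneSpectrum (𝓞 K))} (hn : ↑n ⊆ S.enginePrimes k)
    (hdis : ∀ v ∈ S.enginePrimes k, v ∉ n →
      Disjoint (((hy.h1 k).1.propagateStructure (S.t k).cond) (Sum.inr v))
        ((transverseStructure p S.ρbar S.jbar) (Sum.inr v)))
    (hGDp : ∀ v ∈ S.enginePrimes k, v ∉ n →
      letI := (galoisCohomology.moduleH1 (S.ρbar.toLocal (Sum.inr v))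
        ((S.isScalarLinear_rhobar hy k).restrictField (Place.Completion (Sum.inr v))));
      Module.length (Rk k) ↥(galoisCohomology.submoduleOfStable
        ((S.isScalarLinear_rhobar hy k).restrictField (Place.Completion (Sum.inr v)))
        (((((hy.h1 k).1.propagateStructure (S.t k).cond).modify (transverseStructure p S.ρbar S.jbar) {v} ∅ n).selmerGroup ⊓
          ((semilinearH S.cd.isLift (S.A k).θ.toAddMonoidHom (S.A k).isSemilinear 1) - AddMonoidHom.id _).ker).map
          (galoisCohomology.localization S.ρbar (Sum.inr v) 1))
        (scalarMapH1_mem_map_localization S.ρbar (S.isScalarLinear_rhobar hy k) (Sum.inr v)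
          (scalarMapH1_mem_inf S.ρbar (S.isScalarLinear_rhobar hy k) (S.scalarMapH1_mem_residualSelmer_modify hy k {v} ∅ n)
          (S.scalarMapH1_mem_kerSub hy k)))) = 1)
    (horp : ∀ v ∈ S.enginePrimes k, v ∉ n →
      ((((hy.h1 k).1.propagateStructure (S.t k).cond).modify (transverseStructure p S.ρbar S.jbar) {v} ∅ n).selmerGroup ⊓
          ((semilinearH S.cd.isLift (S.A k).θ.toAddMonoidHom (S.A k).isSemilinear 1) - AddMonoidHom.id _).ker).map
          (galoisCohomology.localization S.ρbar (Sum.inr v) 1) ≤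
          ((hy.h1 k).1.propagateStructure (S.t k).cond) (Sum.inr v) ∨
      ((((hy.h1 k).1.propagateStructure (S.t k).cond).modify (transverseStructure p S.ρbar S.jbar) {v} ∅ n).selmerGroup ⊓
          ((semilinearH S.cd.isLift (S.A k).θ.toAddMonoidHom (S.A k).isSemilinear 1) - AddMonoidHom.id _).ker).map
          (galoisCohomology.localization S.ρbar (Sum.inr v) 1) ≤
          (transverseStructure p S.ρbar S.jbar) (Sum.inr v))
    (hGDm : ∀ v ∈ S.enginePrimes k, v ∉ n →
      letI := (galoisCohomology.moduleH1 (S.ρbar.toLocal (Sum.inr v))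
        ((S.isScalarLinear_rhobar hy k).restrictField (Place.Completion (Sum.inr v))));
      Module.length (Rk k) ↥(galoisCohomology.submoduleOfStable
        ((S.isScalarLinear_rhobar hy k).restrictField (Place.Completion (Sum.inr v)))
        (((((hy.h1 k).1.propagateStructure (S.t k).cond).modify (transverseStructure p S.ρbar S.jbar) {v} ∅ n).selmerGroup ⊓
          ((semilinearH S.cd.isLift (S.A k).θ.toAddMonoidHom (S.A k).isSemilinear 1) + AddMonoidHom.id _).ker).map
          (galoisCohomology.localization S.ρbar (Sum.inr v) 1))
        (scalarMapH1_mem_map_localization S.ρbar (S.isScalarLinear_rhobar hy k) (Sum.inr v)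
          (scalarMapH1_mem_inf S.ρbar (S.isScalarLinear_rhobar hy k) (S.scalarMapH1_mem_residualSelmer_modify hy k {v} ∅ n)
          (S.scalarMapH1_mem_kerAdd hy k)))) = 1)
    (horm : ∀ v ∈ S.enginePrimes k, v ∉ n →
      ((((hy.h1 k).1.propagateStructure (S.t k).cond).modify (transverseStructure p S.ρbar S.jbar) {v} ∅ n).selmerGroup ⊓
          ((semilinearH S.cd.isLift (S.A k).θ.toAddMonoidHom (S.A k).isSemilinear 1) + AddMonoidHom.id _).ker).map
          (galoisCohomology.localization S.ρbar (Sum.inr v) 1) ≤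
          ((hy.h1 k).1.propagateStructure (S.t k).cond) (Sum.inr v) ∨
      ((((hy.h1 k).1.propagateStructure (S.t k).cond).modify (transverseStructure p S.ρbar S.jbar) {v} ∅ n).selmerGroup ⊓
          ((semilinearH S.cd.isLift (S.A k).θ.toAddMonoidHom (S.A k).isSemilinear 1) + AddMonoidHom.id _).ker).map
          (galoisCohomology.localization S.ρbar (Sum.inr v) 1) ≤
          (transverseStructure p S.ρbar S.jbar) (Sum.inr v))
    (hzero : ρp k n = 0) (htwo : 2 ≤ ρm k n)
    {d : galoisCohomology (S.T.ρ k) 1} (hd : d ∈ (((S.t k).atLevel S.jbar n).cond).selmerGroup) (hd0 : d ≠ 0)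
    (hπ : galoisCohomology.scalarMapH1 (S.T.ρ k) (S.T.hlin k) S.π d = 0) :
    ∃ ℓ ∈ S.enginePrimes k, ℓ ∉ n ∧ galoisCohomology.localization (S.T.ρ k) (Sum.inr ℓ) 1 d ≠ 0 ∧
      0 < ρp k (insert ℓ n) ∧ 0 < ρm k (insert ℓ n) ∧
      ρp k (insert ℓ n) + ρm k (insert ℓ n) = ρp k n + ρm k n := by
  have hnσ : ∀ w ∈ n, S.cd.σ • w = w := fun w hw => S.sigma_smul_eq_self_of_mem_L hy (hn hw).1
  have h0σ : ∀ w ∈ (∅ : Finset (HeightOneSpectrum (𝓞 K))), S.cd.σ • w = w :=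
    fun w hw => absurd hw (Finset.notMem_empty w)
  -- Step 1: the residual class
  obtain ⟨ι, hι, dbar, hdbar, hdbar0, rfl⟩ := S.exists_residual_of_scalarMapH1_pi_eq_zero hy k hn hd hd0 hπ
  -- Step 2: `d̄` is an eigenclass (the other eigenpart of `Sel_{F̄(n)}` vanishes)
  obtain ⟨cp, cm, hcp, hcm, hτp, hτm, hsum, -⟩ :=
    S.exists_eigen_decomposition_mem_ne_zero hy k h0σ hnσ hdbar hdbar0
  have hlen0 : letI := galoisCohomology.moduleH1 S.ρbar (S.isScalarLinear_rhobar hy k);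
      Module.length (Rk k) ↥(galoisCohomology.submoduleOfStable (S.isScalarLinear_rhobar hy k)
        ((((hy.h1 k).1.propagateStructure (S.t k).cond).modify (transverseStructure p S.ρbar S.jbar) ∅ ∅ n).selmerGroup ⊓
          ((semilinearH S.cd.isLift (S.A k).θ.toAddMonoidHom (S.A k).isSemilinear 1) - AddMonoidHom.id _).ker)
        (scalarMapH1_mem_inf S.ρbar (S.isScalarLinear_rhobar hy k) (S.scalarMapH1_mem_residualSelmer_modify hy k ∅ ∅ n)
          (S.scalarMapH1_mem_kerSub hy k))) = 0 := by
    rw [← hρp n hn, hzero, Nat.cast_zero]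
  have hvan : cp = 0 :=
    eq_zero_of_length_eq_zero S.ρbar (S.isScalarLinear_rhobar hy k) _ hlen0
      ⟨hcp, (ResidualTau.mem_ker_sub_iff (S.A k) cp).2 hτp⟩
  have hdk : dbar = cm := by rw [hsum, hvan, zero_add]
  -- Step 3: an eigencocycle for `d̄` and the Čebotarev prime (one class)
  obtain ⟨φ, hφc, hφ⟩ := ResidualTau.exists_eigencocycle_of_semilinearH_eq_neg (S.A k) (S.isScalarLinear_rhobar hy k) (S.isUnit_two hy k) cm hτm
  have hseen := S.exists_mem_enginePrimes_localization_ne_zero_single hy hC hp0 hL k n φ (ε := -1) (Or.inr rfl)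
    (fun g => by rw [hφ g, neg_one_smul]) (by rw [hφc, ← hdk]; exact hdbar0)
  obtain ⟨v, hvP, hvn, _hvSig, hlφ, htriv⟩ := hseen
  have hldbar : (galoisCohomology.localization S.ρbar (Sum.inr v) 1) dbar ≠ 0 := by
    rw [hdk, ← hφc]; exact hlφ
  have hins : (↑(insert v n) : Set (HeightOneSpectrum (𝓞 K))) ⊆ S.enginePrimes k := by
    rw [Finset.coe_insert]
    exact Set.insert_subset hvP hn
  -- Step 4: Lemma 1.5.3 (a) for the sign of `d̄`, (b) for the other sign
  have ha := S.length_eigen_insert_add_one_eq hy k hvn _ (S.scalarMapH1_mem_kerAdd hy k) (hdis v hvP hvn) (hGDm v hvP hvn)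
    (horm v hvP hvn) ⟨cm, ⟨by rw [← hdk]; exact hdbar, (ResidualTau.mem_ker_add_iff (S.A k) cm).2 hτm⟩, by rw [← hdk]; exact hldbar⟩
  rw [← hρm _ hins, ← hρm n hn, ← Nat.cast_add_one, ENat.coe_inj] at ha
  have hb := S.length_eigen_insert_eq_add_one hy k hvn _ (S.scalarMapH1_mem_kerSub hy k) (hdis v hvP hvn) (hGDp v hvP hvn)
    (horp v hvP hvn) (fun c hc => by
      rw [eq_zero_of_length_eq_zero S.ρbar (S.isScalarLinear_rhobar hy k) _ hlen0 hc, map_zero])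
  rw [← hρp _ hins, ← hρp n hn, ← Nat.cast_add_one, ENat.coe_inj] at hb
  refine ⟨v, hvP, hvn,
    S.localization_cohomologyMap_residualInclusion_ne_zero hy k ι hι (S.residualInclusion_equivariant hy k ι hι)
      v htriv hldbar, ?_, ?_, ?_⟩ <;> omega

/-- **Howard's Lemma 1.6.4, Case ii — the engine's binder `hchebII` DISCHARGED modulo the Lemma 1.5.3 letters**: if
`(ρ(n)⁻ = 0 ∧ ρ(n)⁺ ≥ 2) ∨ (ρ(n)⁺ = 0 ∧ ρ(n)⁻ ≥ 2)` then for every `d ∈ H¹_{F(n)}(K,T^{(k)})`, `d ≠ 0`, `π d = 0`, there is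
`ℓ ∈ 𝓛^{(2k-1)}`, `ℓ ∉ n`, with `loc_ℓ d ≠ 0`, `ρ(nℓ)⁺ > 0`, `ρ(nℓ)⁻ > 0` and `ρ(nℓ)⁺ + ρ(nℓ)⁻ = ρ(n)⁺ + ρ(n)⁻` — «we may
therefore assume that `ρ(nℓ) = ρ(n)` and `ρ(nℓ)^± > 0` … we are thus reduced to Case i».
[cite: Howard2004HeegnerKolyvagin, Lemma 1.6.4, Case ii (arXiv:1202.6340 p. 12 L15–27)] -/
theorem exists_enginePrime_caseII [Finite Nbar] [∀ k, Finite (N k)]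
    (S : DVRSetting p K R N Rk Nbar Nq) (hy : S.SatisfiesH) (hC : Automorphic.chebotarev_artinRep)
    (hp0 : ((p : ℕ) : R) ≠ 0) (hL : S.LargePrimes) (k : ℕ)
    (ρp ρm : ℕ → Finset (HeightOneSpectrum (𝓞 K)) → ℕ)
    (hρp : ∀ m : Finset (HeightOneSpectrum (𝓞 K)), ↑m ⊆ S.enginePrimes k →
      letI := galoisCohomology.moduleH1 S.ρbar (S.isScalarLinear_rhobar hy k);
      ((ρp k m : ℕ) : ℕ∞) = Module.length (Rk k) ↥(galoisCohomology.submoduleOfStable (S.isScalarLinear_rhobar hy k)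
        ((((hy.h1 k).1.propagateStructure (S.t k).cond).modify (transverseStructure p S.ρbar S.jbar) ∅ ∅ m).selmerGroup ⊓
          ((semilinearH S.cd.isLift (S.A k).θ.toAddMonoidHom (S.A k).isSemilinear 1) - AddMonoidHom.id _).ker)
        (scalarMapH1_mem_inf S.ρbar (S.isScalarLinear_rhobar hy k) (S.scalarMapH1_mem_residualSelmer_modify hy k ∅ ∅ m)
          (S.scalarMapH1_mem_kerSub hy k))))
    (hρm : ∀ m : Finset (HeightOneSpectrum (𝓞 K)), ↑m ⊆ S.enginePrimes k →
      letI := galoisCohomology.moduleH1 S.ρbar (S.isScalarLinear_rhobar hy k);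
      ((ρm k m : ℕ) : ℕ∞) = Module.length (Rk k) ↥(galoisCohomology.submoduleOfStable (S.isScalarLinear_rhobar hy k)
        ((((hy.h1 k).1.propagateStructure (S.t k).cond).modify (transverseStructure p S.ρbar S.jbar) ∅ ∅ m).selmerGroup ⊓
          ((semilinearH S.cd.isLift (S.A k).θ.toAddMonoidHom (S.A k).isSemilinear 1) + AddMonoidHom.id _).ker)
        (scalarMapH1_mem_inf S.ρbar (S.isScalarLinear_rhobar hy k) (S.scalarMapH1_mem_residualSelmer_modify hy k ∅ ∅ m)
          (S.scalarMapH1_mem_kerAdd hy k))))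
    {n : Finset (HeightOneSpectrum (𝓞 K))} (hn : ↑n ⊆ S.enginePrimes k)
    (hdis : ∀ v ∈ S.enginePrimes k, v ∉ n →
      Disjoint (((hy.h1 k).1.propagateStructure (S.t k).cond) (Sum.inr v))
        ((transverseStructure p S.ρbar S.jbar) (Sum.inr v)))
    (hGDp : ∀ v ∈ S.enginePrimes k, v ∉ n →
      letI := (galoisCohomology.moduleH1 (S.ρbar.toLocal (Sum.inr v))
        ((S.isScalarLinear_rhobar hy k).restrictField (Place.Completion (Sum.inr v))));
      Module.length (Rk k) ↥(galoisCohomology.submoduleOfStable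
        ((S.isScalarLinear_rhobar hy k).restrictField (Place.Completion (Sum.inr v)))
        (((((hy.h1 k).1.propagateStructure (S.t k).cond).modify (transverseStructure p S.ρbar S.jbar) {v} ∅ n).selmerGroup ⊓
          ((semilinearH S.cd.isLift (S.A k).θ.toAddMonoidHom (S.A k).isSemilinear 1) - AddMonoidHom.id _).ker).map
          (galoisCohomology.localization S.ρbar (Sum.inr v) 1))
        (scalarMapH1_mem_map_localization S.ρbar (S.isScalarLinear_rhobar hy k) (Sum.inr v)
          (scalarMapH1_mem_inf S.ρbar (S.isScalarLinear_rhobar hy k) (S.scalarMapH1_mem_residualSelmer_modify hy k {v} ∅ n)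
          (S.scalarMapH1_mem_kerSub hy k)))) = 1)
    (horp : ∀ v ∈ S.enginePrimes k, v ∉ n →
      ((((hy.h1 k).1.propagateStructure (S.t k).cond).modify (transverseStructure p S.ρbar S.jbar) {v} ∅ n).selmerGroup ⊓
          ((semilinearH S.cd.isLift (S.A k).θ.toAddMonoidHom (S.A k).isSemilinear 1) - AddMonoidHom.id _).ker).map
          (galoisCohomology.localization S.ρbar (Sum.inr v) 1) ≤
          ((hy.h1 k).1.propagateStructure (S.t k).cond) (Sum.inr v) ∨
      ((((hy.h1 k).1.propagateStructure (S.t k).cond).modify (transverseStructure p S.ρbar S.jbar) {v} ∅ n).selmerGroup ⊓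
          ((semilinearH S.cd.isLift (S.A k).θ.toAddMonoidHom (S.A k).isSemilinear 1) - AddMonoidHom.id _).ker).map
          (galoisCohomology.localization S.ρbar (Sum.inr v) 1) ≤
          (transverseStructure p S.ρbar S.jbar) (Sum.inr v))
    (hGDm : ∀ v ∈ S.enginePrimes k, v ∉ n →
      letI := (galoisCohomology.moduleH1 (S.ρbar.toLocal (Sum.inr v))
        ((S.isScalarLinear_rhobar hy k).restrictField (Place.Completion (Sum.inr v))));
      Module.length (Rk k) ↥(galoisCohomology.submoduleOfStable
        ((S.isScalarLinear_rhobar hy k).restrictField (Place.Completion (Sum.inr v)))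
        (((((hy.h1 k).1.propagateStructure (S.t k).cond).modify (transverseStructure p S.ρbar S.jbar) {v} ∅ n).selmerGroup ⊓
          ((semilinearH S.cd.isLift (S.A k).θ.toAddMonoidHom (S.A k).isSemilinear 1) + AddMonoidHom.id _).ker).map
          (galoisCohomology.localization S.ρbar (Sum.inr v) 1))
        (scalarMapH1_mem_map_localization S.ρbar (S.isScalarLinear_rhobar hy k) (Sum.inr v)
          (scalarMapH1_mem_inf S.ρbar (S.isScalarLinear_rhobar hy k) (S.scalarMapH1_mem_residualSelmer_modify hy k {v} ∅ n)
          (S.scalarMapH1_mem_kerAdd hy k)))) = 1)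
    (horm : ∀ v ∈ S.enginePrimes k, v ∉ n →
      ((((hy.h1 k).1.propagateStructure (S.t k).cond).modify (transverseStructure p S.ρbar S.jbar) {v} ∅ n).selmerGroup ⊓
          ((semilinearH S.cd.isLift (S.A k).θ.toAddMonoidHom (S.A k).isSemilinear 1) + AddMonoidHom.id _).ker).map
          (galoisCohomology.localization S.ρbar (Sum.inr v) 1) ≤
          ((hy.h1 k).1.propagateStructure (S.t k).cond) (Sum.inr v) ∨
      ((((hy.h1 k).1.propagateStructure (S.t k).cond).modify (transverseStructure p S.ρbar S.jbar) {v} ∅ n).selmerGroup ⊓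
          ((semilinearH S.cd.isLift (S.A k).θ.toAddMonoidHom (S.A k).isSemilinear 1) + AddMonoidHom.id _).ker).map
          (galoisCohomology.localization S.ρbar (Sum.inr v) 1) ≤
          (transverseStructure p S.ρbar S.jbar) (Sum.inr v))
    (hcase : (ρm k n = 0 ∧ 2 ≤ ρp k n) ∨ (ρp k n = 0 ∧ 2 ≤ ρm k n))
    {d : galoisCohomology (S.T.ρ k) 1} (hd : d ∈ (((S.t k).atLevel S.jbar n).cond).selmerGroup) (hd0 : d ≠ 0)
    (hπ : galoisCohomology.scalarMapH1 (S.T.ρ k) (S.T.hlin k) S.π d = 0) :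
    ∃ ℓ ∈ S.enginePrimes k, ℓ ∉ n ∧ galoisCohomology.localization (S.T.ρ k) (Sum.inr ℓ) 1 d ≠ 0 ∧
      0 < ρp k (insert ℓ n) ∧ 0 < ρm k (insert ℓ n) ∧
      ρp k (insert ℓ n) + ρm k (insert ℓ n) = ρp k n + ρm k n := by
  rcases hcase with ⟨h0, h2⟩ | ⟨h0, h2⟩
  · exact S.exists_enginePrime_caseII_of_minus_eq_zero hy hC hp0 hL k ρp ρm hρp hρm hn hdis hGDp horp hGDm horm
      h0 h2 hd hd0 hπ
  · exact S.exists_enginePrime_caseII_of_plus_eq_zero hy hC hp0 hL k ρp ρm hρp hρm hn hdis hGDp horp hGDm horm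
      h0 h2 hd hd0 hπ

end DVRSetting

end Literature.NumberTheory.GaloisCohomology.Howard2004

end
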